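import Summits.BirchSwinnertonDyer.BirchSwinnertonDyer.Theorems.AdditiveBranchIMCGordTwoRankOneHeegnerKolyvaginManinIstar
import Summits.BirchSwinnertonDyer.BirchSwinnertonDyer.Theorems.AdditiveBranchIMCGordTwoRankOneHeegnerKolyvaginHorizontalBSDp
import Summits.BirchSwinnertonDyer.BirchSwinnertonDyer.Theorems.AdditiveBranchIMCGordTwoRankOneHeegnerKolyvaginBSDp
import HarnessLib

/-!
# Route `AdditiveBranchIMC` (rung K1), crux `GordTwoRankOne` (item 19358): the Heegner–Kolyvagin road,
# Part 18b — the ♯ rows at EVERY `p ≥ 5` with ONE open binder (item 21398, formerly 20418): Parts 17b/17c/§25 and Part 11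
# restated with the sibling's OPEN Manin item 20136 / Edixhoven-at-`p ≥ 11` REPLACED by Part 18a's
# Mazur–Stevens datum on Kodaira `I₀*` (cite-only Mazur 1978, Abbes–Ullmo 1996, Česnavičius 2018)
# (cell `bsd-addord`, second prover lane `bsd-addord-k1-c3x`, gen 4; `--supports` only)

HONEST FRAMING. THEOREMS ONLY: no definition, no new named fact, no `sorry`; nothing is booked; crux 19358,
item 20498 and the sibling's crux 21398 (formerly 20418) stay OPEN; BSD is not proved by any of this. The sibling route
`AdditiveKolyvaginRoad` (cell `pub/bsd-wall`) is consumed BY NAME; none of its files is touched.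

WHAT. Gens 2–3 served the ♯ sub-rows (`p ≥ 5`, `ρ̄_{E,p}` onto, ♠(1), ♠(2), `p ∤ ∏c(E)`) of cell (G-ord,
`e = 2`) ∩ `r_an = 1` from the sibling's abelian-type crux child (item 21398, formerly 20418) + PUB, taking the Manin-good
frame from the sibling's OPEN crux `ManinGoodOddFrameAdditive` (item 20136, `hM`) at `p ∈ {5,7}` and from
Edixhoven 1991 Thm. 3 (`hmodP hEdxK hNS`) at `p ≥ 11` (Part 11's class-level `BSD(E,p)`: `p ≥ 11` only). By
Part 18a (`exists_modularParametrizationData_not_dvd_of_cellGordTwo_of_irr`: the cell is Kodaira `I₀*`,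
Mazur–Stevens) the frame is PUBLISHED at every odd `p`; this file restates those theorems with `hM` /
`hmodP hEdxK hNS` replaced by the cite-only facts `hMz hAU hC2` (Part 11's class-level forms at `p ≥ 5` are in Part 19's file
`…HeegnerKolyvaginUnitDoors`): §33 Part 17b
§23/§24 (`…_sharp_five_…`: on the ♯ rows at EVERY `p ≥ 5` the ONLY open binder is item 21398 (was 20418); crux BY NAME
`…_five_of_rest` with gen 3's displayed complement), §25 (item 20498 on the ♯ rows) and Part 17c (`BSDp`).
NET (plan E263's edge, sharpened): on the ♯ sub-rows of (G-ord, `e = 2`) ∩ `r_an = 1` at EVERY `p ≥ 5`: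
`21398 ∧ PUB ⟹ 19358`; `21398 ∧ 19357(twists) ∧ PUB ⟹ 20498 ∧ BSDp` (21398 = the sibling's abelian-type crux child,
formerly 20418, restated at its route rev 20 with frames `d_K < −4`). Item 20136 is no longer an input of K1.

References: [WZhang2014] Thm. 1.1, 10.2; [McCallumLMS1991] §1, §5; [JetchevSkinnerWan2017] §7.4.1–7.4.3;
[Kato2004Asterisque] Thm. 14.5 (3); [EdixhovenManin1991] §1; [Mazur1978] Cor. 4.1; [AbbesUllmo1996] Thm. A;
[Cesnavicius2018] Thm. 1.2; [FriedbergHoffstein1995]; [HoffsteinLuo1997] §1; [LiLiuTian2024] Thm. 1.1; [Miller2011LMS] Def. 1.1.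
-/

set_option autoImplicit false
set_option linter.dupNamespace false
noncomputable section
open scoped Classical NumberField
open WeierstrassCurve NumberField IsDedekindDomain Literature.NumberTheory.EllipticCurves
  Literature.NumberTheory.EllipticCurves.ModularForms Literature.NumberTheory.EllipticCurves.Rank1Residual
  Literature.NumberTheory.EllipticCurves.Rank1Residual.Typed Literature.NumberTheory.Automorphic
  Summit.BirchSwinnertonDyer.Rank1Residual Summit.BirchSwinnertonDyer.Rank1Residual.Additive
  Summit.BirchSwinnertonDyer.Rank1Residual.X11b Summit.BirchSwinnertonDyer.Rank1Residual.GaloisImage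
  Summit.BirchSwinnertonDyer.BirchSwinnertonDyer.Theses.AdditiveKolyvaginRoad
  Summit.BirchSwinnertonDyer.BirchSwinnertonDyer.Theorems.AdditiveKolyvaginKernel

namespace Summit.BirchSwinnertonDyer.BirchSwinnertonDyer.Theorems.AdditiveBranchIMCGordTwoRankOne.HeegnerKolyvagin

/-! ### §33 Parts 17b/17c/§25 on the ♯ rows at every `p ≥ 5` — ONE open binder (item 21398, formerly 20418) -/

/-- **Crux `GordTwoRankOne` (item 19358) AT THE PAIR on every ♯ row of cell (G-ord, `e = 2`) at EVERY `p ≥ 5`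
with ONE open binder.** Part 17b's `cellGordTwo_missingLowerBoundAt_rankOne_sharp[_eleven]_of_…` with the
Manin-good datum from Part 18a (cite-only `hMz hAU hC2`; modularity `hnf` inside `hPub`): on the ♯ rows
(`ρ̄_{E,p}` onto, ♠(1), ♠(2), `p ∤ ∏c(E)`) at every `p ≥ 5` the ONLY non-published input is the sibling's crux
child `KolyvaginPrimitiveAdditiveAbelianType` (item 21398, formerly 20418); STEP L′, `RankZeroAdditive` and item 20136 all
drop out. [cite: WZhang2014, Thm. 1.1 and Thm. 10.2] [cite: McCallumLMS1991, §5 Cor. 5.6 (p. 310)]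
[cite: Kato2004Asterisque, Thm. 14.5 (3) (p. 236)] [cite: EdixhovenManin1991, §1] [cite: Mazur1978, Cor. 4.1]
[cite: AbbesUllmo1996, Thm. A] [cite: Cesnavicius2018, Thm. 1.2] [cite: Miller2011LMS, Def. 1.1] -/
theorem cellGordTwo_missingLowerBoundAt_rankOne_sharp_five_of_kolyvaginPrimitiveAdditiveAbelianType
    (hPub : PublishedInputsAdditiveKoly) (hKA : KolyvaginPrimitiveAdditiveAbelianType)
    (hKatoT : Kato2004.rankZero_padicValNat_sha_add_padicValNat_tamagawa_le_of_additive_potGood_of_imageContainsSL2)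
    (hMz : mazur_not_dvd_maninConstant_of_odd)
    (hAU : abbesUllmo_not_dvd_maninConstant_of_not_dvd_level)
    (hC2 : cesnavicius_not_two_dvd_maninConstant_of_two_dvd_level) :
    ∀ (W : WeierstrassCurve ℚ) [W.IsElliptic] [W.IsGloballyMinimal] (p : ℕ) [Fact p.Prime],
      W.analyticRank = 1 → N10.CellGordTwo W p → 5 ≤ p → W.HasSurjectiveModNGaloisRep p →
      (∀ (ℓ : ℕ) [Fact ℓ.Prime], W.HasMultiplicativeReductionAtPrime ℓ →
        ¬ p ∣ padicValInt ℓ W.minimalDiscriminantInt) →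
      (∃ (ℓ₁ ℓ₂ : ℕ) (_ : Fact ℓ₁.Prime) (_ : Fact ℓ₂.Prime), ℓ₁ ≠ ℓ₂ ∧
        W.HasMultiplicativeReductionAtPrime ℓ₁ ∧ W.HasMultiplicativeReductionAtPrime ℓ₂) →
      ¬ p ∣ W.tamagawaProduct → Typed.MissingLowerBoundAt W p := by
  intro W _ _ p _ hr hc2 hp5 hsurjp hsp htwo htam
  haveI : NeZero (W.conductorNorm ℤ) := ⟨(W.conductorNorm_pos_holds).ne'⟩
  have hp : p.Prime := Fact.out
  obtain ⟨hp2, hadd, hG⟩ : p ≠ 2 ∧ Addv W p ∧ TypeGOrd W p := ⟨hc2.1, hc2.2.1, hc2.2.2.1⟩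
  have hCM : ¬ W.HasCM := fun hcm ↦ not_hasSurjectiveModNGaloisRep_of_hasCM W hcm hp hp2 hsurjp
  have hirr : Irr W p := hasIrreducibleModPGaloisRep_of_hasSurjectiveModNGaloisRep W p hsurjp
  have hj : 0 ≤ padicValRat p W.j := not_lt.mp (N10.not_potMult_of_typeGOrd W p hp2 hadd hG)
  have hD : ∃ Dt : ModularParametrizationData W (W.conductorNorm ℤ), ¬ (p : ℤ) ∣ Dt.c :=
    exists_modularParametrizationData_not_dvd_of_cellGordTwo_of_irr hPub.2.2.2.2.2.1 hMz hAU hC2 W p hc2 hirr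
  exact missingLowerBoundAt_rankOne_additive_potGood_of_kolyvaginClasses_lt hPub hKatoT W p hCM hp2 hadd hj hr
    (serre_hasSurjectiveModNGaloisRep_pow_holds W p hp5 hsurjp) hD (fun K _ _ Dt β ι hK hodd hlt hHN hLt hβ hc ↦
      hKA W p K Dt β ι hp5 hadd (Or.inr (subGord_of_typeGOrd_of_addv W p hp2 hG hadd)) hsurjp hsp htwo htam
        hr hK hodd hlt hHN hLt hβ hc)

/-- **Crux `GordTwoRankOne` BY NAME — HORIZONTAL form with ONE open binder on the ♯ rows at every `p ≥ 5`.**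
Part 17b's `gordTwoRankOne_of_kolyvaginPrimitiveAdditiveAbelianType_of_rest` WITHOUT the sibling's Manin item
(`hM`): PUBLISHED binders `hPub`, `hKatoT`, `hLLT` (CM rows, lane A), cite-only `hMz hAU hC2`; ONE OPEN binder
`hKA` (item 21398, formerly 20418); DISPLAYED: the crux on the non-CM OFF-♯ rows (`hRest`: `p = 3`, `ρ̄` not onto, ♠ fails,
or `p ∣ ∏c(E)`) — the same complement as gen 3's theorem. Nothing booked; 19358 stays OPEN.
[cite: WZhang2014, Thm. 1.1 and Thm. 10.2] [cite: McCallumLMS1991, §5 Cor. 5.6 (p. 310)]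
[cite: Kato2004Asterisque, Thm. 14.5 (3) (p. 236)] [cite: LiLiuTian2024, Thm. 1.1 (i)] [cite: EdixhovenManin1991, §1]
[cite: Mazur1978, Cor. 4.1] [cite: AbbesUllmo1996, Thm. A] [cite: Miller2011LMS, Def. 1.1] -/
theorem gordTwoRankOne_of_kolyvaginPrimitiveAdditiveAbelianType_five_of_rest
    (hPub : PublishedInputsAdditiveKoly) (hKA : KolyvaginPrimitiveAdditiveAbelianType)
    (hKatoT : Kato2004.rankZero_padicValNat_sha_add_padicValNat_tamagawa_le_of_additive_potGood_of_imageContainsSL2)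
    (hMz : mazur_not_dvd_maninConstant_of_odd)
    (hAU : abbesUllmo_not_dvd_maninConstant_of_not_dvd_level)
    (hC2 : cesnavicius_not_two_dvd_maninConstant_of_two_dvd_level)
    (hLLT : LiLiuTian2024.thm11_bsdp_of_cm_rank_one)
    (hRest : ∀ (W : WeierstrassCurve ℚ) [W.IsElliptic] [W.IsGloballyMinimal] (p : ℕ) [Fact p.Prime],
      W.analyticRank = 1 → N10.CellGordTwo W p → ¬ W.HasCM →
      ¬ (5 ≤ p ∧ W.HasSurjectiveModNGaloisRep p ∧
        (∀ (ℓ : ℕ) [Fact ℓ.Prime], W.HasMultiplicativeReductionAtPrime ℓ →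
          ¬ p ∣ padicValInt ℓ W.minimalDiscriminantInt) ∧
        (∃ (ℓ₁ ℓ₂ : ℕ) (_ : Fact ℓ₁.Prime) (_ : Fact ℓ₂.Prime), ℓ₁ ≠ ℓ₂ ∧
          W.HasMultiplicativeReductionAtPrime ℓ₁ ∧ W.HasMultiplicativeReductionAtPrime ℓ₂) ∧
        ¬ p ∣ W.tamagawaProduct) → Typed.MissingLowerBoundAt W p) :
    Summit.BirchSwinnertonDyer.BirchSwinnertonDyer.Theses.AdditiveBranchIMC.GordTwoRankOne := by
  intro W _ _ p _ hr hc2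
  by_cases hcm : W.HasCM
  · exact gordTwoRankOne_cm_of_liLiuTian hLLT W p hr hc2 hcm
  by_cases hsh : 5 ≤ p ∧ W.HasSurjectiveModNGaloisRep p ∧
      (∀ (ℓ : ℕ) [Fact ℓ.Prime], W.HasMultiplicativeReductionAtPrime ℓ →
        ¬ p ∣ padicValInt ℓ W.minimalDiscriminantInt) ∧
      (∃ (ℓ₁ ℓ₂ : ℕ) (_ : Fact ℓ₁.Prime) (_ : Fact ℓ₂.Prime), ℓ₁ ≠ ℓ₂ ∧
        W.HasMultiplicativeReductionAtPrime ℓ₁ ∧ W.HasMultiplicativeReductionAtPrime ℓ₂) ∧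
      ¬ p ∣ W.tamagawaProduct
  · obtain ⟨hp5, hsurjp, hsp, htwo, htam⟩ := hsh
    exact cellGordTwo_missingLowerBoundAt_rankOne_sharp_five_of_kolyvaginPrimitiveAdditiveAbelianType hPub hKA
      hKatoT hMz hAU hC2 W p hr hc2 hp5 hsurjp hsp htwo htam
  · exact hRest W p hr hc2 hcm hsh

/-- **STEP L′ (item 20498's body) at EVERY datum of a ♯ row of cell (G-ord, `e = 2`) at `p ≥ 5`** from item
21398 (was 20418) + PUB (incl. cite-only `hMz hAU hC2`) AND the rank-zero LOWER half at the datum's twist (`htwL`, crux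
19357's conclusion at `(Wd, p)`) — gen 3's §25 theorem WITHOUT the sibling's Manin item. On the ♯ rows at every
`p ≥ 5`: `21398 ∧ 19357(twists) ∧ PUB ⟹ 20498`. [cite: WZhang2014, Thm. 1.1 and Thm. 10.2]
[cite: McCallumLMS1991, §5 Cor. 5.6 (p. 310)] [cite: JetchevSkinnerWan2017, §7.4.1 (pp. 29–31)]
[cite: GrossZagier1986, V.§2 and Conj. (V.2.2)] [cite: EdixhovenManin1991, §1] [cite: Miller2011LMS, Def. 1.1] -/
theorem adjustedHeegnerIndexBound_sharp_five_of_kolyvaginPrimitiveAdditiveAbelianType_of_twistLower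
    (hPub : PublishedInputsAdditiveKoly) (hKA : KolyvaginPrimitiveAdditiveAbelianType)
    (hKatoT : Kato2004.rankZero_padicValNat_sha_add_padicValNat_tamagawa_le_of_additive_potGood_of_imageContainsSL2)
    (hMz : mazur_not_dvd_maninConstant_of_odd)
    (hAU : abbesUllmo_not_dvd_maninConstant_of_not_dvd_level)
    (hC2 : cesnavicius_not_two_dvd_maninConstant_of_two_dvd_level)
    (W : WeierstrassCurve ℚ) [W.IsElliptic] [W.IsGloballyMinimal] (p : ℕ) [Fact p.Prime]
    (N : ℕ) [NeZero N] (K : Type) [Field K] [NumberField K]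
    (Dt : ModularParametrizationData W N) (H : HeegnerDatum N (NumberField.discr K)) (ι : K →+* ℂ)
    (P : (W.baseChange K).toAffine.Point)
    (Wd : WeierstrassCurve ℚ) [Wd.IsElliptic] [Wd.IsGloballyMinimal] (Cd : VariableChange ℚ)
    (hr : W.analyticRank = 1) (hc2 : N10.CellGordTwo W p) (hp5 : 5 ≤ p)
    (hsurjp : W.HasSurjectiveModNGaloisRep p)
    (hsp : ∀ (ℓ : ℕ) [Fact ℓ.Prime], W.HasMultiplicativeReductionAtPrime ℓ →
      ¬ p ∣ padicValInt ℓ W.minimalDiscriminantInt)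
    (htwo : ∃ (ℓ₁ ℓ₂ : ℕ) (_ : Fact ℓ₁.Prime) (_ : Fact ℓ₂.Prime), ℓ₁ ≠ ℓ₂ ∧
      W.HasMultiplicativeReductionAtPrime ℓ₁ ∧ W.HasMultiplicativeReductionAtPrime ℓ₂)
    (htam : ¬ p ∣ W.tamagawaProduct)
    (hN : W.conductorNorm ℤ = N) (hK : IsImaginaryQuadratic K) (hHN : SatisfiesHeegnerHypothesis N K)
    (hP : WeierstrassCurve.Affine.Point.map ι.toRatAlgHom P = heegnerPointComplex Dt H)
    (hWd : Cd • W.quadraticTwist (NumberField.discr K : ℚ) = Wd)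
    (htwL : Typed.MissingLowerBoundAt Wd p) :
    (2 * padicValNat p (AddSubgroup.zmultiples P).index : ℤ) ≤
      padicValNat p (W.baseChange K).shaOrder + padicValNat p W.tamagawaProduct +
        padicValNat p Wd.tamagawaProduct + 2 * padicValRat p (Dt.c : ℚ) := by
  have hp : p.Prime := Fact.out
  have hlow : Typed.MissingLowerBoundAt W p :=
    cellGordTwo_missingLowerBoundAt_rankOne_sharp_five_of_kolyvaginPrimitiveAdditiveAbelianType hPub hKA hKatoT
      hMz hAU hC2 W p hr hc2 hp5 hsurjp hsp htwo htam
  obtain ⟨hp2, hadd, -, -⟩ := hc2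
  obtain ⟨hGZ, hKo, -, hGZK, hmod, -, -, -, -, -⟩ := hPub
  have hpN : p ∣ N := by
    rw [← hN]; exact (W.dvd_conductorNorm_iff_not_hasGoodReductionAtPrime p).mpr hadd.1
  have hμ : ¬ p ∣ Units.torsionOrder K := not_dvd_unitsTorsionOrder_of_heegner hK hHN hp hp2 hpN
  by_cases hLt : (W.quadraticTwist (NumberField.discr K : ℚ)).entireLFunction 1 = 0
  · -- degenerate corner (Part 12): torsion Heegner point, index `0`
    have htor : IsOfFinAddOrder P :=
      isOfFinAddOrder_heegnerPoint_of_twist_value_eq_zero W N K Dt H ι P (hGZ N W K) hmod hK hHN hP hr hLt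
    haveI : Infinite (W.baseChange K).toAffine.Point :=
      infinite_point_baseChange_of_analyticRank_eq_one hGZK W K hK.1 hr
    rw [index_zmultiples_eq_zero_of_isOfFinAddOrder htor]
    have e3 : (0 : ℤ) ≤ padicValRat p (Dt.c : ℚ) := by rw [padicValRat.of_int]; positivity
    have e4 : (0 : ℤ) ≤ (padicValNat p (W.baseChange K).shaOrder : ℤ) + padicValNat p W.tamagawaProduct +
        padicValNat p Wd.tamagawaProduct := by positivity
    simp only [padicValNat_zero_right, Nat.cast_zero, mul_zero]
    linarith
  · -- generic case: Part 9's no-free-lunch mechanism at this datum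
    subst hN
    have hu : padicValRat p (Cd.u : ℚ) = 0 :=
      padicValRat_u_eq_zero_of_twist_minimal' W p K hK hHN hadd.1 Cd hWd
    exact adjustedIndexBound_of_missingLowerBoundAt_of_twistLower W p (W.conductorNorm ℤ) K Dt H ι P (hGZ _ W K)
      (hKo _ W K) hGZK hmod hK hHN hP hp2 hμ hr hLt Wd Cd hWd hu hlow htwL

/-- **`BSD(E,p)`, BOTH halves, at every ♯ pair of cell (G-ord, `e = 2`) ∩ `r_an = 1`, EVERY `p ≥ 5`, from item
21398 (was 20418) + crux 19357's conclusion at the Heegner-field twists + PUB** — Part 17c's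
`cellGordTwo_bsdp_rankOne_sharp[_eleven]_of_kolyvaginPrimitiveAdditiveAbelianType_of_twistLower` WITHOUT the
sibling's Manin item / Edixhoven: LOWER(E) by §33, UPPER(E) by Part 6 at the odd Hoffstein–Luo frame of Part
18a (`exists_oddHeegnerFrame_lt_of_exists_not_dvd` on the Mazur–Stevens datum). Two OPEN binders, both
registered items' conclusions (21398, 19357), nothing else. [cite: WZhang2014, Thm. 1.1 and Thm. 10.2]
[cite: McCallumLMS1991, §1 Theorem (Kolyvagin), p. 296] [cite: Kato2004Asterisque, Thm. 14.5 (3) (p. 236)]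
[cite: JetchevSkinnerWan2017, §7.4.1–7.4.3 (pp. 29–31)] [cite: EdixhovenManin1991, §1] [cite: Mazur1978, Cor. 4.1]
[cite: Miller2011LMS, §1 and Def. 1.1] -/
theorem cellGordTwo_bsdp_rankOne_sharp_five_of_kolyvaginPrimitiveAdditiveAbelianType_of_twistLower
    (hPub : PublishedInputsAdditiveKoly) (hKA : KolyvaginPrimitiveAdditiveAbelianType)
    (hKatoT : Kato2004.rankZero_padicValNat_sha_add_padicValNat_tamagawa_le_of_additive_potGood_of_imageContainsSL2)
    (hMz : mazur_not_dvd_maninConstant_of_odd)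
    (hAU : abbesUllmo_not_dvd_maninConstant_of_not_dvd_level)
    (hC2 : cesnavicius_not_two_dvd_maninConstant_of_two_dvd_level)
    (hTwL : ∀ (W : WeierstrassCurve ℚ) [W.IsElliptic] [W.IsGloballyMinimal] (p : ℕ) [Fact p.Prime]
      (K : Type) [Field K] [NumberField K]
      (Wd : WeierstrassCurve ℚ) [Wd.IsElliptic] [Wd.IsGloballyMinimal] (Cd : VariableChange ℚ),
      W.analyticRank = 1 → N10.CellGordTwo W p → (∀ n : ℕ, W.HasSurjectiveModNGaloisRep (p ^ n : ℕ)) →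
      IsImaginaryQuadratic K → SatisfiesHeegnerHypothesis (W.conductorNorm ℤ) K →
      (W.quadraticTwist (NumberField.discr K : ℚ)).entireLFunction 1 ≠ 0 →
      Cd • W.quadraticTwist (NumberField.discr K : ℚ) = Wd → Typed.MissingLowerBoundAt Wd p) :
    ∀ (W : WeierstrassCurve ℚ) [W.IsElliptic] [W.IsGloballyMinimal] (p : ℕ) [Fact p.Prime],
      W.analyticRank = 1 → N10.CellGordTwo W p → 5 ≤ p → W.HasSurjectiveModNGaloisRep p →
      (∀ (ℓ : ℕ) [Fact ℓ.Prime], W.HasMultiplicativeReductionAtPrime ℓ →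
        ¬ p ∣ padicValInt ℓ W.minimalDiscriminantInt) →
      (∃ (ℓ₁ ℓ₂ : ℕ) (_ : Fact ℓ₁.Prime) (_ : Fact ℓ₂.Prime), ℓ₁ ≠ ℓ₂ ∧
        W.HasMultiplicativeReductionAtPrime ℓ₁ ∧ W.HasMultiplicativeReductionAtPrime ℓ₂) →
      ¬ p ∣ W.tamagawaProduct → BSDp W p := by
  intro W _ _ p _ hr hc2 hp5 hsurjp hsp htwo htam
  haveI : NeZero (W.conductorNorm ℤ) := ⟨(W.conductorNorm_pos_holds).ne'⟩
  have hp : p.Prime := Fact.out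
  obtain ⟨hp2, hadd, hG⟩ : p ≠ 2 ∧ Addv W p ∧ TypeGOrd W p := ⟨hc2.1, hc2.2.1, hc2.2.2.1⟩
  -- LOWER(E,p): §33
  have hlow : Typed.MissingLowerBoundAt W p :=
    cellGordTwo_missingLowerBoundAt_rankOne_sharp_five_of_kolyvaginPrimitiveAdditiveAbelianType hPub hKA hKatoT
      hMz hAU hC2 W p hr hc2 hp5 hsurjp hsp htwo htam
  -- UPPER(E,p): Part 6 at the odd Hoffstein–Luo frame on the Mazur–Stevens datum (Part 18a)
  have hirr : Irr W p := hasIrreducibleModPGaloisRep_of_hasSurjectiveModNGaloisRep W p hsurjp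
  have hsurj : ∀ m : ℕ, W.HasSurjectiveModNGaloisRep (p ^ m : ℕ) :=
    serre_hasSurjectiveModNGaloisRep_pow_holds W p hp5 hsurjp
  have hD : ∃ Dt : ModularParametrizationData W (W.conductorNorm ℤ), ¬ (p : ℤ) ∣ Dt.c :=
    exists_modularParametrizationData_not_dvd_of_cellGordTwo_of_irr hPub.2.2.2.2.2.1 hMz hAU hC2 W p hc2 hirr
  obtain ⟨hGZ, hKo, hB, hGZK, hmod, hnf, hHL, -, -, -⟩ := hPub
  obtain ⟨K, _, _, Dt, H, ι, P, Wd, _, _, Cd, hK, -, -, -, hHN, hP, hc, hμ, hLt, hWd⟩ :=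
    exists_oddHeegnerFrame_lt_of_exists_not_dvd hnf hHL W p hr hp2 hD
  have hup : Typed.MissingUpperBoundAt W p :=
    missingUpperBoundAt_rankOne_additive_of_twistLower W p K Dt H ι P (hGZ _ W K) (hKo _ W K) (hB _ W K)
      hGZK hmod hr hp5 hsurjp htam hK hHN hP hc hμ hLt Wd Cd hWd hadd.1
      (hTwL W p K Wd Cd hr hc2 hsurj hK hHN hLt hWd)
  exact Typed.bsdp_of_missingPPartAt W p hGZK (le_of_eq hr) (Typed.missingPPartAt_of_lower_of_upper W p hlow hup)

end Summit.BirchSwinnertonDyer.BirchSwinnertonDyer.Theorems.AdditiveBranchIMCGordTwoRankOne.HeegnerKolyvagin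

end
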